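import Summits.HubbardSuperconductivity.HubbardLadder.R3R4Props
import Literature.MathematicalPhysics.QuantumLattice.FinDimSpectrumSectorGibbsLimit
import Literature.MathematicalPhysics.QuantumLattice.GroundStateEnclosure
import HarnessLib

/-!
# Rung R3 — soundness of the ED-enclosure certificate, part 1/4: linear algebra (§1)

HONEST FRAMING (page 1): ladder R1–R4 with certified numbers; no claim on H/H₀.
(The r3 seat's `R3R4Sound` split into four files for the 400-line limit, statements unchanged:
`R3R4SoundLinAlg` = §1, `R3R4SoundWindow` = §2–§4, `R3R4SoundMultiplet` = §5, `R3R4Sound` = §6 +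
the overview docstring; import `R3R4Sound` to get everything. The `ℓ²` norm is the tree's
`Literature.MathematicalPhysics.QuantumLattice.eucNorm` (`ApproximateEigenvectorLemmas`) and the observable
enclosure is a corollary of `GroundStateEnclosure.norm_expect_sub_expect_le`; the Davis–Kahan bound here,
`eucNorm_sub_proj_le_of_complement_gap`, is the variant of `GroundStateEnclosure.eucNorm_sub_proj_le_of_residual`
with the gap hypothesis on the TRIAL vector's complement inside a sector and the conclusion for every sector
ground state, which is the shape a certificate producer supplies.)

§1: residual + complement gap ⇒ eigenvector enclosure `‖ψ - ⟨φ, ψ⟩ φ‖ ≤ ε / (β - ρ)` for every unit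
ground vector `ψ` of a Hermitian `H` on a sector `K` (Davis–Kahan / Kato–Temple type argument, no spectral
theorem needed) and the observable enclosure `|⟨ψ, O ψ⟩ - ⟨φ, O φ⟩| ≤ 2 M (δ + δ²)` for `|⟨u, O v⟩| ≤ M ‖u‖ ‖v‖`.
No certificate exists; these are soundness edges.
-/

namespace Summit.HubbardSuperconductivity.HubbardLadder

open Matrix Finset Filter Literature.Probability.LatticeModels
  Literature.MathematicalPhysics.QuantumLattice
open scoped ComplexOrder Topology InnerProductSpace

noncomputable section

/-! ## §1 Linear algebra: residual + complement gap ⇒ eigenvector and observable enclosure -/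

section ResidualComplement

variable {n : Type*} [Fintype n] [DecidableEq n]

omit [DecidableEq n] in
/-- `‖v‖ = 0 ↔ v = 0`. [folklore] -/
theorem eucNorm_eq_zero_iff {v : n → ℂ} : eucNorm v = 0 ↔ v = 0 := by
  unfold eucNorm
  rw [norm_eq_zero, WithLp.toLp_eq_zero]

omit [DecidableEq n] in
/-- Real scalings of a Rayleigh numerator. [folklore] -/
theorem re_star_smul_dotProduct_mulVec_smul (A : Matrix n n ℂ) (c : ℝ) (w : n → ℂ) :
    (star ((c : ℂ) • w) ⬝ᵥ A *ᵥ ((c : ℂ) • w)).re = c ^ 2 * (star w ⬝ᵥ A *ᵥ w).re := by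
  rw [star_smul, mulVec_smul, smul_dotProduct, dotProduct_smul, smul_eq_mul, smul_eq_mul,
    Complex.star_def, Complex.conj_ofReal, ← mul_assoc, ← Complex.ofReal_mul,
    Complex.re_ofReal_mul, sq]

omit [DecidableEq n] in
/-- Normalising a nonzero vector. [folklore] -/
theorem star_normalize_dotProduct_self {w : n → ℂ} (hw : eucNorm w ≠ 0) :
    star ((((eucNorm w)⁻¹ : ℝ) : ℂ) • w) ⬝ᵥ ((((eucNorm w)⁻¹ : ℝ) : ℂ) • w) = 1 := by
  rw [star_dotProduct_self_eq_eucNorm_sq, eucNorm_smul, Complex.norm_real, Real.norm_eq_abs,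
    abs_of_nonneg (inv_nonneg.2 (eucNorm_nonneg w)), inv_mul_cancel₀ hw]
  norm_num

omit [DecidableEq n] in
/-- A lower bound `β` on the Rayleigh quotient over the unit vectors on the ray of `w` gives
`β ‖w‖² ≤ re ⟨w, A w⟩`. [folklore] -/
theorem mul_eucNorm_sq_le_of_unit_bound {A : Matrix n n ℂ} {β : ℝ} {w : n → ℂ}
    (h : ∀ c : ℝ, 0 < c → star ((c : ℂ) • w) ⬝ᵥ ((c : ℂ) • w) = 1 →
      β ≤ (star ((c : ℂ) • w) ⬝ᵥ A *ᵥ ((c : ℂ) • w)).re) :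
    β * eucNorm w ^ 2 ≤ (star w ⬝ᵥ A *ᵥ w).re := by
  by_cases hw0 : eucNorm w = 0
  · rw [eucNorm_eq_zero_iff.1 hw0]
    simp
  · have hpos : 0 < eucNorm w := lt_of_le_of_ne (eucNorm_nonneg w) (Ne.symm hw0)
    have hb := h (eucNorm w)⁻¹ (inv_pos.2 hpos) (star_normalize_dotProduct_self hw0)
    rw [re_star_smul_dotProduct_mulVec_smul] at hb
    have h2 := mul_le_mul_of_nonneg_right hb (sq_nonneg (eucNorm w))
    calc β * eucNorm w ^ 2 ≤ (eucNorm w)⁻¹ ^ 2 * (star w ⬝ᵥ A *ᵥ w).re * eucNorm w ^ 2 := h2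
      _ = (star w ⬝ᵥ A *ᵥ w).re := by field_simp

/-- **Residual + complement gap ⇒ eigenvector enclosure** (Davis–Kahan / Kato–Temple type, finite
dimension, no spectral theorem). `A` Hermitian, `K` a subspace, `φ ∈ K` a unit vector with
`re ⟨φ, A φ⟩ ≤ ρ`, residual `‖A φ - σ φ‖ ≤ ε` (any scalar `σ`), and `β > ρ` a lower bound on the
Rayleigh quotient of `A` on the unit vectors of `K ∩ φ^⊥`. Then every unit `ψ ∈ K` with
`A ψ = E_K ψ`, `E_K = minEnergyOn A K` (a sector ground state), satisfies
`‖ψ - ⟨φ, ψ⟩ φ‖ ≤ ε / (β - ρ)`. Proof: with `w = ψ - αφ`, `β‖w‖² ≤ re⟨w, A w⟩ = E_K‖w‖² - re(α⟨w, r⟩)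
≤ ρ‖w‖² + ε‖w‖`. [folklore] -/
theorem eucNorm_sub_proj_le_of_complement_gap {A : Matrix n n ℂ} (hA : A.IsHermitian)
    (K : Submodule ℂ (n → ℂ)) {φ ψ : n → ℂ} {σ : ℂ} {ρ ε β : ℝ}
    (hφK : φ ∈ K) (hφ : star φ ⬝ᵥ φ = 1) (hρ : (star φ ⬝ᵥ A *ᵥ φ).re ≤ ρ)
    (hres : eucNorm (A *ᵥ φ - σ • φ) ≤ ε) (hβ : ρ < β)
    (hcomp : ∀ v ∈ K, star φ ⬝ᵥ v = 0 → star v ⬝ᵥ v = 1 → β ≤ (star v ⬝ᵥ A *ᵥ v).re)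
    (hψK : ψ ∈ K) (hψ : star ψ ⬝ᵥ ψ = 1)
    (heig : A *ᵥ ψ = ((A.minEnergyOn K : ℝ) : ℂ) • ψ) :
    eucNorm (ψ - (star φ ⬝ᵥ ψ) • φ) ≤ ε / (β - ρ) := by
  set α : ℂ := star φ ⬝ᵥ ψ with hα
  set w : n → ℂ := ψ - α • φ with hw
  set r : n → ℂ := A *ᵥ φ - σ • φ with hr
  set E : ℝ := A.minEnergyOn K with hE
  have hε : 0 ≤ ε := (eucNorm_nonneg _).trans hres
  have hβρ : 0 < β - ρ := sub_pos.2 hβ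
  have hφw : star φ ⬝ᵥ w = 0 := by
    rw [hw, dotProduct_sub, dotProduct_smul, hφ, smul_eq_mul, mul_one, sub_self]
  have hwφ : star w ⬝ᵥ φ = 0 := by rw [Matrix.star_dotProduct, hφw, star_zero]
  have hwK : w ∈ K := K.sub_mem hψK (K.smul_mem α hφK)
  have hψ_dec : ψ = α • φ + w := by rw [hw]; abel
  have hEρ : E ≤ ρ := (minEnergyOn_le_rayleigh_of_mem hA K hφK hφ).trans hρ
  have hα1 : ‖α‖ ≤ 1 := by
    have h := norm_star_dotProduct_le φ ψ
    rwa [eucNorm_eq_one hφ, eucNorm_eq_one hψ, one_mul] at h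
  have hwψ : star w ⬝ᵥ ψ = ((eucNorm w ^ 2 : ℝ) : ℂ) := by
    have h : star w ⬝ᵥ ψ = star w ⬝ᵥ (α • φ + w) := by rw [← hψ_dec]
    rw [h, dotProduct_add, dotProduct_smul, hwφ, smul_zero, zero_add,
      star_dotProduct_self_eq_eucNorm_sq]
  have hwAφ : star w ⬝ᵥ A *ᵥ φ = star w ⬝ᵥ r := by
    have h : A *ᵥ φ = r + σ • φ := by rw [hr]; abel
    rw [h, dotProduct_add, dotProduct_smul, hwφ, smul_zero, add_zero]
  have hwAw : star w ⬝ᵥ A *ᵥ w =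
      (E : ℂ) * ((eucNorm w ^ 2 : ℝ) : ℂ) - α * (star w ⬝ᵥ r) := by
    have hAw : A *ᵥ w = (E : ℂ) • ψ - α • (A *ᵥ φ) := by
      rw [hw, mulVec_sub, mulVec_smul, heig]
    rw [hAw, dotProduct_sub, dotProduct_smul, dotProduct_smul, hwψ, hwAφ, smul_eq_mul,
      smul_eq_mul]
  -- upper bound on re ⟨w, A w⟩
  have hup : (star w ⬝ᵥ A *ᵥ w).re ≤ ρ * eucNorm w ^ 2 + ε * eucNorm w := by
    rw [hwAw, Complex.sub_re, ← Complex.ofReal_mul, Complex.ofReal_re]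
    have h2 : -(α * (star w ⬝ᵥ r)).re ≤ ε * eucNorm w := by
      calc -(α * (star w ⬝ᵥ r)).re ≤ ‖α * (star w ⬝ᵥ r)‖ := by
            rw [← Complex.neg_re]
            exact (Complex.re_le_norm _).trans_eq (norm_neg _)
        _ = ‖α‖ * ‖star w ⬝ᵥ r‖ := norm_mul _ _
        _ ≤ 1 * (eucNorm w * ε) :=
            mul_le_mul hα1 ((norm_star_dotProduct_le w r).trans
              (mul_le_mul_of_nonneg_left hres (eucNorm_nonneg w))) (norm_nonneg _) zero_le_one
        _ = ε * eucNorm w := by ring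
    have h3 : E * eucNorm w ^ 2 ≤ ρ * eucNorm w ^ 2 :=
      mul_le_mul_of_nonneg_right hEρ (sq_nonneg _)
    linarith
  -- lower bound on re ⟨w, A w⟩ from the complement hypothesis
  have hlow : β * eucNorm w ^ 2 ≤ (star w ⬝ᵥ A *ᵥ w).re :=
    mul_eucNorm_sq_le_of_unit_bound fun c _ hunit =>
      hcomp _ (K.smul_mem _ hwK) (by rw [dotProduct_smul, hφw, smul_zero]) hunit
  have hkey : (β - ρ) * eucNorm w ^ 2 ≤ ε * eucNorm w := by nlinarith
  rw [le_div_iff₀ hβρ]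
  by_cases hw0 : eucNorm w = 0
  · rw [hw0, zero_mul]; exact hε
  · have hpos : 0 < eucNorm w := lt_of_le_of_ne (eucNorm_nonneg w) (Ne.symm hw0)
    have h : (β - ρ) * eucNorm w ≤ ε := by
      rw [sq, ← mul_assoc] at hkey
      exact le_of_mul_le_mul_right hkey hpos
    linarith

omit [DecidableEq n] in
/-- **The complement bound from a rank-one-shifted lower bound (proved).** If
`β ≤ re ⟨v, A v⟩ + c |⟨φ, v⟩|²` for all unit `v ∈ K` — i.e. `A + c φφ† - β ⪰ 0` on `K`, a plain
positive-semidefiniteness statement (by interlacing `λ_min(A + c φφ†) ≤ λ₁(A)` on `K`, so nothing is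
lost for large `c`) — then `β` bounds the Rayleigh quotient of `A` on `K ∩ φ^⊥` from below: the
hypothesis `hcomp` of `eucNorm_sub_proj_le_of_complement_gap`. This is the form in which a certificate
producer supplies the hard input `β`. [folklore] -/
theorem complement_of_shifted_lower_bound {A : Matrix n n ℂ} (K : Submodule ℂ (n → ℂ))
    {φ : n → ℂ} {β c : ℝ}
    (hshift : ∀ v ∈ K, star v ⬝ᵥ v = 1 → β ≤ (star v ⬝ᵥ A *ᵥ v).re + c * ‖star φ ⬝ᵥ v‖ ^ 2) :
    ∀ v ∈ K, star φ ⬝ᵥ v = 0 → star v ⬝ᵥ v = 1 → β ≤ (star v ⬝ᵥ A *ᵥ v).re := by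
  intro v hv hφv h1
  have h := hshift v hv h1
  rwa [hφv, norm_zero, zero_pow two_ne_zero, mul_zero, add_zero] at h

omit [DecidableEq n] in
/-- **Observable enclosure from eigenvector enclosure.** If `|⟨u, O v⟩| ≤ M ‖u‖ ‖v‖`, `φ`, `ψ` are
unit vectors and `‖ψ - ⟨φ, ψ⟩ φ‖ ≤ δ`, then `|⟨ψ, O ψ⟩ - ⟨φ, O φ⟩| ≤ 2 M (δ + δ²)`
(`ψ = αφ + w`, `|α|² = 1 - ‖w‖²`; the four cross terms) — the sesquilinear-bound form of the tree's
`Literature.MathematicalPhysics.QuantumLattice.norm_expect_sub_expect_le` (`GroundStateEnclosure`), of which it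
is a corollary. [folklore] -/
theorem norm_expect_sub_expect_le_of_proj {O : Matrix n n ℂ} {M δ : ℝ} {φ ψ : n → ℂ}
    (hO : ∀ u v : n → ℂ, ‖star u ⬝ᵥ O *ᵥ v‖ ≤ M * eucNorm u * eucNorm v)
    (hφ : star φ ⬝ᵥ φ = 1) (hψ : star ψ ⬝ᵥ ψ = 1)
    (hδ : eucNorm (ψ - (star φ ⬝ᵥ ψ) • φ) ≤ δ) :
    ‖star ψ ⬝ᵥ O *ᵥ ψ - star φ ⬝ᵥ O *ᵥ φ‖ ≤ 2 * M * (δ + δ ^ 2) := by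
  -- Corollary of the tree's `norm_expect_sub_expect_le` (GroundStateEnclosure): the sesquilinear
  -- bound `hO` gives the operator-norm bound `‖O v‖ ≤ M ‖v‖` (take `u = O v`).
  have hφ1 : eucNorm φ = 1 := eucNorm_eq_one hφ
  have hM : 0 ≤ M := by
    have h := hO φ φ
    rw [hφ1, mul_one, mul_one] at h
    exact (norm_nonneg _).trans h
  have hA : ∀ v : n → ℂ, eucNorm (O *ᵥ v) ≤ M * eucNorm v := by
    intro v
    rcases (eucNorm_nonneg (O *ᵥ v)).eq_or_lt with h0 | hpos
    · rw [← h0]; exact mul_nonneg hM (eucNorm_nonneg v)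
    · have h := hO (O *ᵥ v) v
      rw [star_dotProduct_self_eq_eucNorm_sq, Complex.norm_real, Real.norm_eq_abs,
        abs_of_nonneg (sq_nonneg _), sq, mul_assoc, mul_left_comm] at h
      exact le_of_mul_le_mul_left h hpos
  have h := norm_expect_sub_expect_le hφ hψ hδ O hA
  calc ‖star ψ ⬝ᵥ O *ᵥ ψ - star φ ⬝ᵥ O *ᵥ φ‖ ≤ M * (2 * δ + 2 * δ ^ 2) := h
    _ = 2 * M * (δ + δ ^ 2) := by ring

omit [DecidableEq n] in
/-- Real-part form of the observable enclosure (for correlators recorded as real parts).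
[folklore] -/
theorem abs_re_expect_sub_le_of_proj {O : Matrix n n ℂ} {M δ : ℝ} {φ ψ : n → ℂ}
    (hO : ∀ u v : n → ℂ, ‖star u ⬝ᵥ O *ᵥ v‖ ≤ M * eucNorm u * eucNorm v)
    (hφ : star φ ⬝ᵥ φ = 1) (hψ : star ψ ⬝ᵥ ψ = 1)
    (hδ : eucNorm (ψ - (star φ ⬝ᵥ ψ) • φ) ≤ δ) :
    |(star ψ ⬝ᵥ O *ᵥ ψ).re - (star φ ⬝ᵥ O *ᵥ φ).re| ≤ 2 * M * (δ + δ ^ 2) := by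
  rw [← Complex.sub_re]
  exact (Complex.abs_re_le_norm _).trans (norm_expect_sub_expect_le_of_proj hO hφ hψ hδ)

end ResidualComplement

end

end Summit.HubbardSuperconductivity.HubbardLadder
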